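import Literature.Analysis.FluidPDE.FluidComputer.ThresholdTransferStage
import HarnessLib

/-!
# Fluid computer blueprint — threshold gate, stage 3:
# what the hypotheses of `exists_output_loaded` FORCE

HONEST FRAMING: low prior, high value-of-information experiment on Tao's machine paradigm; NOT a
claim that NS blows up. Finite-dimensional bookkeeping about the explicit five-mode threshold
circuit `thresholdCircuit` (`ThresholdGate.lean`); nothing is asserted about any fluid equation.

## Why (an honesty check on the cell's own REACH theorem)

`exists_output_loaded` (`ThresholdTransferStage.lean`) makes stage 3 of the threshold gate —
ignition + transfer — a theorem for every `δ`-admissible forcing, CONDITIONAL on a list of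
closed-form inequalities among the design constants. This file asks what that list forces, and
answers: a SUB-LIST of those hypotheses (the positivity conventions, the ignition data at the input
readout, the trigger floor/ceiling inequalities `hfloor`/`hCm`, the level floor `hLfloor`, the
clock balance `hbal`, and the six `hign` inequalities at ONE explicit state of the box slice)
already implies

  `4·R_b² < u₀·(r c₀ T_A)`,  `4μ(a₁ + R_b) < r c₀`  and the parameter-only  `64·ν·μ² < ε·r²`

(`transfer_hypotheses_necessary`). The mechanism of the bound: `hign`'s build-up budget must absorb
the observability transient `κR_b²/(rC_m)` from an output that the box slice allows to be `≤ 0`, so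
the build-up needs more than `4R_b²/u₀ > 4` radians AT THE TRIGGER FLOOR `c₀`; the angle budget
charges that time at the CEILING `C_m`, and `hCm` (sign-free rate ceiling `νB + μR_b`) with the
clock floor of `hign` then forces `c₀ > 4μ(a₁ + R_b)/r`, while `hfloor`/`hbal` force
`c₀ < C ≤ a₀√(ε/ν)`.

On the cell's calibration ladder (HOME/code/thgate/thgate.py, `design('threshold', A)`:
`ε = 1/5`, `ν = 120A²`, `μ = 24A²`, `r = 300√24·A²`) one has `64νμ² = (256/25)·A²·(εr²)`
(`ladder_ratio`), so the necessary condition FAILS for every abruptness `A ≥ 5/16`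
(`ladder_violates`): AS STATED, the hypotheses of `exists_output_loaded` — hence of `transferStage`
and `fullCycle` — are satisfied by NO design of the calibration ladder, whatever the free constants.
The theorem is correct and its architecture (ignition → clock side → build-up → conversion →
certificate → composition) is kernel-checked, but its constants must be sharpened (angle-indexed
build-up with the small transient, a band decomposition for the overdamped Lyapunov weight, the
clock-budget trigger cost `∫νc²` instead of `sup c`, the output floor inside `hign`) before any
ladder design inhabits it. Recorded in the cell's ASSEMBLY.md §2k.3⁺⁺⁺⁺(e).
[cite: Tao2016AveragedNS, §5.5 Thm 5.3 (5.5)]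
-/

noncomputable section

open Set

namespace Literature.Analysis.FluidPDE.FluidComputer

open Literature.Analysis.FluidPDE.Tao2016AveragedNS

variable {ε σ ν μ r κ δ a₀ : ℝ}

/-! ### §1. An explicit state of the ignition box slice with non-positive output -/

/-- Energy of an explicit five-vector. [folklore] -/
theorem energy_vec5 (y0 y1 y2 y3 y4 : ℝ) :
    energy ![y0, y1, y2, y3, y4] = y0 ^ 2 + y1 ^ 2 + y2 ^ 2 + y3 ^ 2 + y4 ^ 2 := by
  simp [energy, Fin.sum_univ_five]

/-- **A state of the ignition slice with output `≤ 0`.** Under the energy inequalities of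
`exists_first_ignition` at the readout `p` (energy inside the ball, carrier/energy inequality
`hEa`), the box tube `boxTube ε ν r δ a₁ R_b C p T_ig` contains the state
`(√(E(p) - p₁² - C² - (p₃² + p₄²)), p₁, C, 0, -√(p₃² + p₄²))`: trigger AT the ignition level, all
modes within `R_b`, carrier `≥ a₁`, output `≤ 0`. [folklore] -/
theorem exists_slicePoint {p : Fin 5 → ℝ} {a₁ C Rb Tig : ℝ}
    (hε : 0 ≤ ε) (hν : 0 ≤ ν) (hr : 0 ≤ r) (hδ : 0 ≤ δ) (hRb : 0 ≤ Rb) (hTig : 0 ≤ Tig)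
    (ha₁ : 0 ≤ a₁) (hC : 0 ≤ C) (hb : 0 ≤ p 1)
    (hER : energy p + 10 * (δ * Rb) * Tig < Rb ^ 2)
    (hEa : a₁ ^ 2 + 10 * (δ * Rb) * Tig +
        max |p 1 - (ν * C ^ 2 + δ) * Tig| |p 1 + (ε * Rb ^ 2 + δ) * Tig| ^ 2 + C ^ 2 +
        (Real.sqrt (p 3 ^ 2 + p 4 ^ 2) + (r * Rb * C + 2 * δ) * Tig) ^ 2 < energy p) :
    ∃ Y ∈ boxTube ε ν r δ a₁ Rb C p Tig, Y 2 = C ∧ (∀ i, |Y i| ≤ Rb) ∧ a₁ ≤ Y 0 ∧ Y 4 ≤ 0 := by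
  set m := Real.sqrt (p 3 ^ 2 + p 4 ^ 2) with hm_def
  have hm0 : 0 ≤ m := Real.sqrt_nonneg _
  have hm2 : m ^ 2 = p 3 ^ 2 + p 4 ^ 2 := Real.sq_sqrt (by positivity)
  have hEp : energy p = p 0 ^ 2 + p 1 ^ 2 + p 2 ^ 2 + p 3 ^ 2 + p 4 ^ 2 := by
    rw [energy, Fin.sum_univ_five]
  have h10 : 0 ≤ 10 * (δ * Rb) * Tig := by positivity
  have hRb2 : energy p < Rb ^ 2 := by linarith
  have hE0 : 0 ≤ energy p := by rw [hEp]; positivity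
  have hRbpos : 0 < Rb := by
    rcases eq_or_lt_of_le hRb with h | h
    · exfalso; rw [← h] at hRb2; linarith
    · exact h
  -- the two lower bounds hidden in `hEa`
  have hmax : p 1 ^ 2 ≤ max |p 1 - (ν * C ^ 2 + δ) * Tig| |p 1 + (ε * Rb ^ 2 + δ) * Tig| ^ 2 := by
    have h1 : p 1 ≤ p 1 + (ε * Rb ^ 2 + δ) * Tig := le_add_of_nonneg_right (by positivity)
    have h2 : p 1 ≤ max |p 1 - (ν * C ^ 2 + δ) * Tig| |p 1 + (ε * Rb ^ 2 + δ) * Tig| :=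
      (h1.trans (le_abs_self _)).trans (le_max_right _ _)
    exact pow_le_pow_left₀ hb h2 2
  have hmk : m ^ 2 ≤ (m + (r * Rb * C + 2 * δ) * Tig) ^ 2 := by
    have : m ≤ m + (r * Rb * C + 2 * δ) * Tig := le_add_of_nonneg_right (by positivity)
    exact pow_le_pow_left₀ hm0 this 2
  set D := energy p - p 1 ^ 2 - C ^ 2 - m ^ 2 with hD_def
  have hDa : a₁ ^ 2 < D := by simp only [hD_def]; linarith
  have hD0 : 0 ≤ D := (sq_nonneg _).trans hDa.le
  set y0 := Real.sqrt D with hy0_def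
  have hy00 : 0 ≤ y0 := Real.sqrt_nonneg _
  have hy02 : y0 ^ 2 = D := Real.sq_sqrt hD0
  have ha1y : a₁ ≤ y0 := by
    rw [hy0_def, ← Real.sqrt_sq ha₁]
    exact Real.sqrt_le_sqrt hDa.le
  have hC2 : C ^ 2 < Rb ^ 2 := by nlinarith [sq_nonneg a₁, sq_nonneg m]
  have hp12 : p 1 ^ 2 < Rb ^ 2 := by
    have := sq_apply_le_energy p 1
    linarith
  have hm2R : m ^ 2 < Rb ^ 2 := by
    have h3 := sq_apply_le_energy p 3
    have h4 := sq_apply_le_energy p 4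
    nlinarith [sq_nonneg (p 0), sq_nonneg (p 1), sq_nonneg (p 2)]
  have hy0R : y0 ^ 2 < Rb ^ 2 := by
    rw [hy02, hD_def]; nlinarith [sq_nonneg (p 1), sq_nonneg C, sq_nonneg m]
  -- the witness and its coordinates
  set Y : Fin 5 → ℝ := ![y0, p 1, C, 0, -m] with hY_def
  have e0 : Y 0 = y0 := rfl
  have e1 : Y 1 = p 1 := rfl
  have e2 : Y 2 = C := rfl
  have e3 : Y 3 = 0 := rfl
  have e4 : Y 4 = -m := rfl
  have hEY : energy Y = energy p := by
    rw [hY_def, energy_vec5, hy02, hD_def]; ring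
  refine ⟨Y, ?_, e2, ?_, ?_, ?_⟩
  · refine ⟨?_, ?_, ?_, ?_, ?_, ?_⟩
    · rw [e0]; exact ha1y
    · rw [e1]
      have : 0 ≤ (ν * C ^ 2 + δ) * Tig := by positivity
      linarith
    · rw [e1]
      have : 0 ≤ (ε * Rb ^ 2 + δ) * Tig := by positivity
      linarith
    · rw [e2, abs_of_nonneg hC]
    · have h34 : Real.sqrt (Y 3 ^ 2 + Y 4 ^ 2) = m := by
        rw [e3, e4]
        have : (0 : ℝ) ^ 2 + (-m) ^ 2 = m ^ 2 := by ring
        rw [this, Real.sqrt_sq hm0]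
      rw [h34]
      exact le_add_of_nonneg_right (by positivity)
    · rw [hEY, sub_self, abs_zero]; positivity
  · intro i
    fin_cases i
    · show |Y 0| ≤ Rb
      rw [e0]; exact (abs_lt_of_sq_lt_sq hy0R hRb).le
    · show |Y 1| ≤ Rb
      rw [e1]; exact (abs_lt_of_sq_lt_sq hp12 hRb).le
    · show |Y 2| ≤ Rb
      rw [e2]; exact (abs_lt_of_sq_lt_sq hC2 hRb).le
    · show |Y 3| ≤ Rb
      rw [e3, abs_zero]; exact hRb
    · show |Y 4| ≤ Rb
      rw [e4, abs_neg]; exact (abs_lt_of_sq_lt_sq hm2R hRb).le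
  · rw [e0]; exact ha1y
  · rw [e4]; linarith

/-! ### §2. The necessary conditions -/

/-- **WHAT THE HYPOTHESES OF `exists_output_loaded` FORCE.** Every hypothesis below is, verbatim, a
hypothesis of `exists_output_loaded` (with the input readout `p := x 0`; the curve itself, the
preload, `hlong`, `hLceil`, `hceil`, `hτ` and the `β ≤ 1`, `λ` conventions are not even needed).
They imply: the build-up needs more than `4R_b²/u₀` radians at the trigger floor
(`4R_b² < u₀·(r c₀ T_A)`), the floor is bounded below (`4μ(a₁ + R_b) < r c₀`), and the
parameter-only inequality `64νμ² < εr²`. Consequently the full hypothesis list is EMPTY whenever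
`64νμ² ≥ εr²` — e.g. on the whole calibration ladder (`ladder_violates`). [folklore] -/
theorem transfer_hypotheses_necessary {p : Fin 5 → ℝ}
    {T₃ Tig a₁ C Rb c₀ Cm B Θd TA β lam u₀ L Eout : ℝ}
    (hε : 0 ≤ ε) (hσ : 0 ≤ σ) (hν : 0 ≤ ν) (hμ : 0 ≤ μ) (hr : 0 < r) (hκ : 0 < κ) (hδ : 0 ≤ δ)
    (hRb : 0 ≤ Rb) (ha₀ : 0 ≤ a₀) (ha₁ : a₀ < a₁) (hTig : 0 < Tig) (hT₃ : Tig < T₃)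
    (hc₀ : 0 < c₀) (hCm0 : 0 ≤ Cm) (hB0 : 0 ≤ B) (hΘd : 0 < Θd) (hTA : 0 ≤ TA) (hβ0 : 0 < β)
    (hu₀ : 0 ≤ u₀)
    (ha : a₁ ≤ p 0) (hc0 : 0 ≤ p 2) (hc0C : p 2 < C) (hs : δ < σ * a₀ ^ 2)
    (hER : energy p + 10 * (δ * Rb) * Tig < Rb ^ 2)
    (hEa : a₁ ^ 2 + 10 * (δ * Rb) * Tig +
        max |p 1 - (ν * C ^ 2 + δ) * Tig| |p 1 + (ε * Rb ^ 2 + δ) * Tig| ^ 2 + C ^ 2 +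
        (Real.sqrt (p 3 ^ 2 + p 4 ^ 2) + (r * Rb * C + 2 * δ) * Tig) ^ 2 < energy p)
    (hbal : ν * C ^ 2 + δ ≤ ε * a₀ ^ 2) (hρ₁ : 0 < ν * p 1 - μ * Rb)
    (hfloor : c₀ + δ * (T₃ - Tig) < C)
    (hCm : C + ((ν * B + μ * Rb) / r + (σ * Rb ^ 2 + δ) / (r * c₀)) * (r * Cm * TA + Θd) < Cm)
    (hLfloor : β * (r * Cm) + κ * δ * (T₃ - Tig) ≤ L)
    (hign : ∀ t ∈ Icc 0 Tig, ∀ Y ∈ boxTube ε ν r δ a₁ Rb C p t, Y 2 = C →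
      (∀ i, |Y i| ≤ Rb) →
      Y 1 + (ε * Rb ^ 2 + δ) * (T₃ - Tig) ≤ B ∧
      0 ≤ Y 1 - ν * Cm / r * (r * Cm * TA + Θd) - δ * (T₃ - Tig) ∧
      μ ^ 2 * (Y 0 ^ 2 + Y 3 ^ 2 + 2 * μ * Rb * Cm / r * (r * Cm * TA + Θd) +
          4 * (Rb * δ) * (T₃ - Tig)) ≤
        ν ^ 2 * (Y 1 - ν * Cm / r * (r * Cm * TA + Θd) - δ * (T₃ - Tig)) ^ 2 ∧
      u₀ ≤ energy Y - 10 * (δ * Rb) * (T₃ - Tig) - B ^ 2 - Cm ^ 2 - (L / κ) ^ 2 ∧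
      L ≤ κ * (Y 4 - κ / (r * Cm) * Rb ^ 2 +
        κ / (r * Cm) / 2 * ((1 - 1 / 2) * u₀) * (r * c₀ * TA) -
        (κ / (r * Cm) * Rb * (ε * Rb ^ 2 + σ * Rb * Cm + μ * Cm ^ 2 + δ) + δ) * TA) ∧
      Eout ≤ energy Y - 10 * (δ * Rb) * (T₃ - Tig) - B ^ 2 - Cm ^ 2 -
        Real.exp (-lam * Θd) * ((1 + β / 2) * (energy Y + 10 * (δ * Rb) * (T₃ - Tig)) +
          8 * Rb * (ε * Rb ^ 2 + σ * Rb * Cm + μ * Cm ^ 2 + δ) *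
            Real.exp (lam * (r * Cm * TA + Θd)) * (T₃ - Tig)) / (1 - β / 2)) :
    4 * Rb ^ 2 < u₀ * (r * c₀ * TA) ∧ 4 * μ * (a₁ + Rb) < r * c₀ ∧
      64 * ν * μ ^ 2 < ε * r ^ 2 := by
  -- positivity of the data
  set T' := T₃ - Tig with hT'_def
  have hT' : 0 < T' := by rw [hT'_def]; linarith only [hT₃]
  set Θt := r * Cm * TA + Θd with hΘt_def
  have hΘt0 : 0 ≤ Θt := by
    have : 0 ≤ r * Cm * TA := by positivity
    rw [hΘt_def]; linarith only [this, hΘd]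
  have ha₀pos : 0 < a₀ := by
    rcases eq_or_lt_of_le ha₀ with h | h
    · exfalso
      rw [← h] at hs
      have : σ * (0 : ℝ) ^ 2 = 0 := by ring
      linarith only [hs, this, hδ]
    · exact h
  have ha₁0 : 0 < a₁ := ha₀pos.trans ha₁
  have hμRb : 0 ≤ μ * Rb := by positivity
  have hνpos : 0 < ν := by
    rcases eq_or_lt_of_le hν with h | h
    · exfalso
      rw [← h] at hρ₁
      linarith only [hρ₁, hμRb]
    · exact h
  have hp1 : 0 < p 1 := by
    have : 0 < ν * p 1 := by linarith only [hρ₁, hμRb]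
    exact pos_of_mul_pos_right this hν
  have hC : 0 < C := lt_of_le_of_lt hc0 hc0C
  have hcoef : 0 ≤ (ν * B + μ * Rb) / r + (σ * Rb ^ 2 + δ) / (r * c₀) := by positivity
  have hCmC : C < Cm := by linarith only [hCm, mul_nonneg hcoef hΘt0]
  have hCmpos : 0 < Cm := hC.trans hCmC
  set K₀ := κ / (r * Cm) with hK₀_def
  have hK₀ : 0 < K₀ := by rw [hK₀_def]; positivity
  have hL : 0 < L := by
    have i1 : 0 < β * (r * Cm) := by positivity
    have i2 : 0 ≤ κ * δ * T' := by positivity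
    linarith only [i1, i2, hLfloor]
  have hRbp0 : p 0 < Rb := by
    have h0 := sq_apply_le_energy p 0
    have h10 : 0 ≤ 10 * (δ * Rb) * Tig := by positivity
    have : p 0 ^ 2 < Rb ^ 2 := by linarith only [h0, h10, hER]
    exact lt_of_le_of_lt (le_abs_self _) (abs_lt_of_sq_lt_sq this hRb)
  have hRba₁ : a₁ < Rb := lt_of_le_of_lt ha hRbp0
  -- the explicit slice state and the six inequalities there
  obtain ⟨Y, hYbox, hY2, hYabs, hYa, hY4⟩ :=
    exists_slicePoint (ε := ε) (ν := ν) (r := r) (δ := δ) hε hν hr.le hδ hRb hTig.le ha₁0.le hC.le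
      hp1.le hER hEa
  obtain ⟨h1, h2, h3, h4, h5, -⟩ := hign Tig ⟨hTig.le, le_rfl⟩ Y hYbox hY2 hYabs
  -- (N5) the build-up budget: `4R_b² < u₀ · (r c₀ T_A)`
  have hloss : 0 ≤ (K₀ * Rb * (ε * Rb ^ 2 + σ * Rb * Cm + μ * Cm ^ 2 + δ) + δ) * TA := by
    positivity
  have hbr : 0 < Y 4 - K₀ * Rb ^ 2 + K₀ / 2 * ((1 - 1 / 2) * u₀) * (r * c₀ * TA) -
      (K₀ * Rb * (ε * Rb ^ 2 + σ * Rb * Cm + μ * Cm ^ 2 + δ) + δ) * TA := by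
    by_contra hle
    have := mul_le_mul_of_nonneg_left (not_lt.1 hle) hκ.le
    linarith only [this, h5, hL]
  have N5a : K₀ * Rb ^ 2 < K₀ / 2 * ((1 - 1 / 2) * u₀) * (r * c₀ * TA) := by
    linarith only [hbr, hY4, hloss]
  have N5 : 4 * Rb ^ 2 < u₀ * (r * c₀ * TA) := by
    by_contra hle
    have := mul_le_mul_of_nonneg_left (not_lt.1 hle) hK₀.le
    linarith only [this, N5a]
  -- `u₀ < R_b²`, hence more than four radians at the floor
  have hEY : energy Y < Rb ^ 2 := by
    have := (abs_le.1 hYbox.2.2.2.2.2).2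
    have h10 : 0 ≤ 10 * (δ * Rb) * Tig := by positivity
    linarith only [this, hER, h10]
  have hu₀Rb : u₀ < Rb ^ 2 := by
    have h10 : 0 ≤ 10 * (δ * Rb) * T' := by positivity
    have hB2 : 0 ≤ B ^ 2 := sq_nonneg B
    have hCm2 : 0 ≤ Cm ^ 2 := sq_nonneg Cm
    have hLκ : 0 ≤ (L / κ) ^ 2 := sq_nonneg (L / κ)
    linarith only [h4, h10, hB2, hCm2, hLκ, hEY]
  have hrcTA : 4 < r * c₀ * TA := by
    by_contra hle
    have := mul_le_mul_of_nonneg_left (not_lt.1 hle) hu₀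
    linarith only [this, N5, hu₀Rb]
  -- (N3) the clock floor: `μ a₁ + ν²C_mΘ/r ≤ ν B`
  have hextra : 0 ≤ Y 3 ^ 2 + 2 * μ * Rb * Cm / r * Θt + 4 * (Rb * δ) * T' := by positivity
  have hW0 : 0 ≤ ν * (Y 1 - ν * Cm / r * Θt - δ * T') := mul_nonneg hν h2
  have hsq : (μ * Y 0) ^ 2 ≤ (ν * (Y 1 - ν * Cm / r * Θt - δ * T')) ^ 2 := by
    have i1 : (μ * Y 0) ^ 2 = μ ^ 2 * Y 0 ^ 2 := by ring
    have i2 : (ν * (Y 1 - ν * Cm / r * Θt - δ * T')) ^ 2 =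
        ν ^ 2 * (Y 1 - ν * Cm / r * Θt - δ * T') ^ 2 := by ring
    have i3 := mul_nonneg (sq_nonneg μ) hextra
    rw [i1, i2]
    linarith only [h3, i3]
  have hμY : μ * Y 0 ≤ ν * (Y 1 - ν * Cm / r * Θt - δ * T') :=
    (abs_le_of_sq_le_sq' hsq hW0).2
  have hY0 : μ * a₁ ≤ μ * Y 0 := mul_le_mul_of_nonneg_left hYa hμ
  have hνδ : 0 ≤ ν * (δ * T') := by positivity
  have hY1B : Y 1 ≤ B := by
    have : 0 ≤ (ε * Rb ^ 2 + δ) * T' := by positivity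
    linarith only [h1, this]
  have hνY1 : ν * Y 1 ≤ ν * B := mul_le_mul_of_nonneg_left hY1B hν
  have N3 : μ * a₁ + ν * (ν * Cm / r * Θt) ≤ ν * B := by
    linarith only [hY0, hμY, hνδ, hνY1]
  -- (N4) the trigger ceiling: `C + μ(a₁ + R_b)Θ/r < C_m`
  have hΘr : 0 ≤ Θt / r := by positivity
  have hσt : 0 ≤ (σ * Rb ^ 2 + δ) / (r * c₀) * Θt := by positivity
  have hCm' : C + (ν * B + μ * Rb) / r * Θt < Cm := by linarith only [hCm, hσt]
  have hN3r := mul_le_mul_of_nonneg_right N3 hΘr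
  have hνsq : 0 ≤ ν * (ν * Cm / r * Θt) * (Θt / r) := by positivity
  have hdiv : (ν * B + μ * Rb) / r * Θt = ν * B * (Θt / r) + μ * Rb * (Θt / r) := by ring
  have N4 : C + μ * a₁ * (Θt / r) + μ * Rb * (Θt / r) < Cm := by
    linarith only [hCm', hN3r, hνsq, hdiv]
  -- the angle budget charges the build-up time at the ceiling: `C_m T_A ≤ Θ/r`
  have hΘTA : Cm * TA ≤ Θt / r := by
    rw [le_div_iff₀ hr, hΘt_def]
    have : Cm * TA * r = r * Cm * TA := by ring
    linarith only [hΘd, this]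
  have hP : 0 ≤ μ * (a₁ + Rb) := by positivity
  have N4' : C + μ * (a₁ + Rb) * (Cm * TA) < Cm := by
    have := mul_le_mul_of_nonneg_left hΘTA hP
    linarith only [this, N4]
  -- (N9) combine with `r c₀ T_A > 4`: `4μ(a₁ + R_b) < r c₀`
  have hPC : 0 ≤ μ * (a₁ + Rb) * Cm := by positivity
  have step1 : r * c₀ * C + μ * (a₁ + Rb) * Cm * (r * c₀ * TA) < r * c₀ * Cm := by
    have := mul_lt_mul_of_pos_left N4' (mul_pos hr hc₀)
    linarith only [this]
  have step2 : μ * (a₁ + Rb) * Cm * 4 ≤ μ * (a₁ + Rb) * Cm * (r * c₀ * TA) :=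
    mul_le_mul_of_nonneg_left hrcTA.le hPC
  have hrcC : 0 < r * c₀ * C := by positivity
  have N9 : 4 * μ * (a₁ + Rb) < r * c₀ := by
    by_contra hle
    have := mul_le_mul_of_nonneg_right (not_lt.1 hle) hCmpos.le
    linarith only [this, step1, step2, hrcC]
  -- (N2) `c₀ < C ≤ a₀√(ε/ν)`, and the parameter-only consequence
  have hc₀C : c₀ < C := by
    have : 0 ≤ δ * T' := by positivity
    linarith only [hfloor, this]
  have hνc : ν * c₀ ^ 2 < ε * a₀ ^ 2 := by
    have hcc : c₀ ^ 2 < C ^ 2 := by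
      have := mul_pos (sub_pos.2 hc₀C) (add_pos hC hc₀)
      linarith only [this]
    have := mul_lt_mul_of_pos_left hcc hνpos
    linarith only [this, hbal, hδ]
  have h8 : 8 * μ * a₀ ≤ 4 * μ * (a₁ + Rb) := by
    have : 0 ≤ μ * (a₁ + Rb - 2 * a₀) := mul_nonneg hμ (by linarith only [ha₁, hRba₁])
    linarith only [this]
  have h9 : 8 * μ * a₀ < r * c₀ := h8.trans_lt N9
  have h9sq : (8 * μ * a₀) ^ 2 < (r * c₀) ^ 2 := by
    have hsum : 0 < r * c₀ + 8 * μ * a₀ := by positivity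
    have := mul_pos (sub_pos.2 h9) hsum
    linarith only [this]
  have hfin : 64 * ν * μ ^ 2 * a₀ ^ 2 < ε * r ^ 2 * a₀ ^ 2 := by
    have e1 : 64 * ν * μ ^ 2 * a₀ ^ 2 = ν * (8 * μ * a₀) ^ 2 := by ring
    have e2 : ν * (r * c₀) ^ 2 = r ^ 2 * (ν * c₀ ^ 2) := by ring
    have i1 : ν * (8 * μ * a₀) ^ 2 ≤ ν * (r * c₀) ^ 2 := mul_le_mul_of_nonneg_left h9sq.le hν
    have i2 : r ^ 2 * (ν * c₀ ^ 2) < r ^ 2 * (ε * a₀ ^ 2) :=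
      mul_lt_mul_of_pos_left hνc (by positivity)
    linarith only [e1, e2, i1, i2]
  have ha0sq : 0 < a₀ ^ 2 := by positivity
  refine ⟨N5, N9, ?_⟩
  by_contra hle
  have := mul_le_mul_of_nonneg_right (not_lt.1 hle) ha0sq.le
  linarith only [this, hfin]

/-! ### §3. The calibration ladder violates the necessary condition -/

/-- Trigger amplifier of the calibration ladder: `ν = G/ε = 120A²` (`G = 2L_c A²`, `L_c = 12`,
`ε = 1/5`). [folklore] -/
def ladderNu (A : ℝ) : ℝ := 120 * A ^ 2

/-- Attenuating amplifier of the calibration ladder: `μ = νεt₀ = 24A²` (`t₀ = 1`). [folklore] -/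
def ladderMu (A : ℝ) : ℝ := 24 * A ^ 2

/-- Rotor coupling of the calibration ladder: `r = od·Γ·√G/ε = 300√24·A²` (`od = 10`, `Γ = 6A`).
[folklore] -/
def ladderR (A : ℝ) : ℝ := 300 * Real.sqrt 24 * A ^ 2

/-- On the ladder `64νμ² = (256/25)·A²·(εr²)` with `ε = 1/5`. [folklore] -/
theorem ladder_ratio (A : ℝ) :
    64 * ladderNu A * ladderMu A ^ 2 = 256 / 25 * A ^ 2 * (1 / 5 * ladderR A ^ 2) := by
  have h24 : Real.sqrt 24 * Real.sqrt 24 = 24 := Real.mul_self_sqrt (by norm_num)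
  simp only [ladderNu, ladderMu, ladderR]
  linear_combination (-184320 * A ^ 6) * h24

/-- **The calibration ladder violates the necessary condition** `64νμ² < εr²` for every abruptness
`A ≥ 5/16` (the cell's ladder is `A = 2, 3, 5, 8, 13, 21`): by `transfer_hypotheses_necessary`
the hypotheses of `exists_output_loaded` / `transferStage` / `fullCycle` are then satisfied by NO
choice of the remaining constants. [folklore] -/
theorem ladder_violates {A : ℝ} (hA : 5 / 16 ≤ A) :
    ¬ 64 * ladderNu A * ladderMu A ^ 2 < 1 / 5 * ladderR A ^ 2 := by
  rw [ladder_ratio]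
  intro h
  have hx : 0 ≤ 1 / 5 * ladderR A ^ 2 := by positivity
  have hA2 : 1 ≤ 256 / 25 * A ^ 2 := by nlinarith
  nlinarith [mul_nonneg (sub_nonneg.2 hA2) hx]

end Literature.Analysis.FluidPDE.FluidComputer

end
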